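import Mathlib
import HarnessLib

/-!
# `SU(2)` fixes no complex line in `ℂ²`

`SU(2)` acts transitively on the complex lines of `ℂ²`; the consequence used in practice is that NO line is
invariant under all of `SU(2)`, even after twisting the standard representation by scalars (a character).  We
prove it directly with two explicit special unitary matrices: the quarter turn `J = !![0,-1;1,0]` moves every
non-isotropic vector (`v₀² + v₁² ≠ 0`) off its line, and the phase matrix `diag(i, -i)` moves the isotropic ones.

* `quarterTurn_mem_SU2`, `phase_mem_SU2`, `quarterTurn_mulVec`, `phase_mulVec` — the two witnesses;
* `exists_SU2_moves_line` — for `v ≠ 0` and `c ≠ 0` there is `g ∈ SU(2)` with `c • (g v), v` linearly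
  independent; `exists_SU2_moves_line_twisted` — one `g` works for every non-zero scalar twist `c`;
* pointwise linear algebra of pairs used with it: `linearIndependent_pair_smul`,
  `span_eq_of_not_linearIndependent`, `mem_span_of_not_linearIndependent`,
  `not_linearIndependent_pair_of_mem_span` ("two vectors on one line are dependent").

Everything is elementary. [folklore]

## Provenance

Staged by the pub-hodgecm formalisation cell (DAG-node prover #01 lineage) under the LEAN-IN-TREE rule; it
supersedes the `section Fibre` of the cell's standalone package file `HodgeCM/PerL34/LineField.lean` and the two
`span` lemmas of `HodgeCM/PerL34/LineFieldRigidity.lean` (namespace `HodgeCM.PerL34.LineField` ↦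
`Literature.LinearAlgebra.Matrix.SU2Line`; `not_linearIndependent_of_mem_span` ↦
`not_linearIndependent_pair_of_mem_span`, other short names unchanged).

## Not here

Transitivity of `SU(2)` on lines as such, and the identification of an isotropy representation with the
standard representation of `U(2)` twisted by a character (inputs of the callers).
-/

set_option autoImplicit false

open Matrix

namespace Literature.LinearAlgebra.Matrix

namespace SU2Line

/-! ### Pairs of vectors on a line -/

section Pairs

variable {K W : Type*} [DivisionRing K] [AddCommGroup W] [Module K W]

/-- Two non-zero vectors that are NOT linearly independent span the same line. [folklore] -/
theorem span_eq_of_not_linearIndependent {a b : W} (hab : ¬ LinearIndependent K ![a, b]) (ha : a ≠ 0)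
    (hb : b ≠ 0) : (K ∙ a) = (K ∙ b) := by
  rw [LinearIndependent.pair_iff] at hab
  push Not at hab
  obtain ⟨s, t, hst, hst0⟩ := hab
  -- `s • a + t • b = 0` with `(s, t) ≠ (0, 0)`; both are non-zero since `a, b ≠ 0`.
  have hs : s ≠ 0 := by
    intro hs
    apply hst0 hs
    rw [hs, zero_smul, zero_add] at hst
    exact (smul_eq_zero.mp hst).resolve_right hb
  have ht : t ≠ 0 := by
    intro ht'
    rw [ht', zero_smul, add_zero] at hst
    exact hs ((smul_eq_zero.mp hst).resolve_right ha)
  have hb' : b = (-(t⁻¹ * s)) • a := by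
    have : t • b = -(s • a) := eq_neg_of_add_eq_zero_right hst
    calc b = t⁻¹ • (t • b) := by rw [smul_smul, inv_mul_cancel₀ ht, one_smul]
      _ = (-(t⁻¹ * s)) • a := by rw [this, smul_neg, smul_smul, neg_smul]
  have ha' : a = (-(s⁻¹ * t)) • b := by
    have : s • a = -(t • b) := eq_neg_of_add_eq_zero_left hst
    calc a = s⁻¹ • (s • a) := by rw [smul_smul, inv_mul_cancel₀ hs, one_smul]
      _ = (-(s⁻¹ * t)) • b := by rw [this, smul_neg, smul_smul, neg_smul]
  apply le_antisymm
  · rw [Submodule.span_singleton_le_iff_mem, ha']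
    exact Submodule.smul_mem _ _ (Submodule.mem_span_singleton_self b)
  · rw [Submodule.span_singleton_le_iff_mem, hb']
    exact Submodule.smul_mem _ _ (Submodule.mem_span_singleton_self a)

/-- A vector not linearly independent from a non-zero `a` lies on the line of `a`. [folklore] -/
theorem mem_span_of_not_linearIndependent {a b : W} (hab : ¬ LinearIndependent K ![a, b]) (ha : a ≠ 0) :
    b ∈ (K ∙ a) := by
  by_cases hb : b = 0
  · rw [hb]; exact Submodule.zero_mem _
  · rw [span_eq_of_not_linearIndependent hab ha hb]; exact Submodule.mem_span_singleton_self b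

end Pairs

section ComplexPairs

variable {W : Type*} [AddCommGroup W] [Module ℂ W]

/-- Two vectors on the line of a third are linearly dependent. [folklore] -/
theorem not_linearIndependent_pair_of_mem_span {a b c : W} (hb : b ∈ (ℂ ∙ a)) (hc : c ∈ (ℂ ∙ a)) :
    ¬ LinearIndependent ℂ ![b, c] := by
  intro hli
  rw [Submodule.mem_span_singleton] at hb hc
  obtain ⟨s, rfl⟩ := hb
  obtain ⟨t, rfl⟩ := hc
  rw [LinearIndependent.pair_iff] at hli
  -- `t • (s • a) - s • (t • a) = 0`
  have h := hli t (-s) (by rw [smul_smul, neg_smul, smul_smul, mul_comm t s]; exact add_neg_cancel _)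
  -- so `t = 0`, whence the second vector is `0`, contradicting independence
  have hli' : LinearIndependent ℂ ![s • a, t • a] := by
    rw [LinearIndependent.pair_iff]; exact hli
  have := hli'.ne_zero 1
  simp [h.1] at this

/-- Scaling the first vector by a non-zero scalar preserves linear independence of a pair. [folklore] -/
theorem linearIndependent_pair_smul {x y : W} (h : LinearIndependent ℂ ![x, y]) (c : ℂ) (hc : c ≠ 0) :
    LinearIndependent ℂ ![c • x, y] := by
  rw [LinearIndependent.pair_iff] at h ⊢
  intro s t hst
  have hst' : (s * c) • x + t • y = 0 := by rwa [mul_smul]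
  obtain ⟨h1, h2⟩ := h (s * c) t hst'
  exact ⟨(mul_eq_zero.mp h1).resolve_right hc, h2⟩

end ComplexPairs

/-! ### The two witnesses in `SU(2)` -/

/-- The quarter turn `J = !![0,-1; 1,0]` lies in `SU(2)`. [folklore] -/
theorem quarterTurn_mem_SU2 : !![(0 : ℂ), -1; 1, 0] ∈ Matrix.specialUnitaryGroup (Fin 2) ℂ := by
  rw [Matrix.mem_specialUnitaryGroup_iff, Matrix.mem_unitaryGroup_iff]
  refine ⟨?_, ?_⟩
  · ext i j
    fin_cases i <;> fin_cases j <;>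
      simp [Matrix.mul_apply, Fin.sum_univ_two, Matrix.star_eq_conjTranspose, Matrix.conjTranspose_apply]
  · simp [Matrix.det_fin_two]

/-- The phase matrix `diag(i, −i)` lies in `SU(2)`. [folklore] -/
theorem phase_mem_SU2 : !![Complex.I, 0; 0, -Complex.I] ∈ Matrix.specialUnitaryGroup (Fin 2) ℂ := by
  rw [Matrix.mem_specialUnitaryGroup_iff, Matrix.mem_unitaryGroup_iff]
  refine ⟨?_, ?_⟩
  · ext i j
    fin_cases i <;> fin_cases j <;>
      simp [Matrix.mul_apply, Fin.sum_univ_two, Matrix.star_eq_conjTranspose, Matrix.conjTranspose_apply]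
  · simp [Matrix.det_fin_two]

/-- `J v = (-v₁, v₀)`. [folklore] -/
theorem quarterTurn_mulVec (v : Fin 2 → ℂ) : !![(0 : ℂ), -1; 1, 0] *ᵥ v = ![-(v 1), v 0] := by
  rw [Matrix.mulVec_fin_two]; simp

/-- `diag(i,-i) v = (i v₀, -i v₁)`. [folklore] -/
theorem phase_mulVec (v : Fin 2 → ℂ) :
    !![Complex.I, 0; 0, -Complex.I] *ᵥ v = ![Complex.I * v 0, -(Complex.I * v 1)] := by
  rw [Matrix.mulVec_fin_two]; simp

/-- **No `SU(2)`-invariant line in `ℂ²`, with a scalar twist allowed**: for every non-zero `v ∈ ℂ²` and every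
non-zero scalar `c` there is `g ∈ SU(2)` with `c • (g v)` off the line `ℂ v`. [folklore] -/
theorem exists_SU2_moves_line (v : Fin 2 → ℂ) (hv : v ≠ 0) (c : ℂ) (hc : c ≠ 0) :
    ∃ g ∈ Matrix.specialUnitaryGroup (Fin 2) ℂ, LinearIndependent ℂ ![c • (g *ᵥ v), v] := by
  have hv' : ¬ (v 0 = 0 ∧ v 1 = 0) := by
    rintro ⟨h0, h1⟩; apply hv; funext i; fin_cases i <;> simp [h0, h1]
  by_cases hq : v 0 ^ 2 + v 1 ^ 2 = 0
  · -- isotropic vector (`v₀² + v₁² = 0`, so `v₀, v₁ ≠ 0`): use the phase matrix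
    refine ⟨!![Complex.I, 0; 0, -Complex.I], phase_mem_SU2, ?_⟩
    have h0 : v 0 ≠ 0 := by
      intro h0; apply hv'; refine ⟨h0, ?_⟩
      have : v 1 ^ 2 = 0 := by rw [h0] at hq; simpa using hq
      exact pow_eq_zero_iff (n := 2) (by norm_num) |>.mp this
    have h1 : v 1 ≠ 0 := by
      intro h1; apply hv'; refine ⟨?_, h1⟩
      have : v 0 ^ 2 = 0 := by rw [h1] at hq; simpa using hq
      exact pow_eq_zero_iff (n := 2) (by norm_num) |>.mp this
    rw [phase_mulVec]
    have hne : c • ![Complex.I * v 0, -(Complex.I * v 1)] ≠ 0 := by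
      intro h
      have e0 := congr_fun h 0
      simp only [Pi.smul_apply, smul_eq_mul, Matrix.cons_val_zero, Pi.zero_apply, mul_eq_zero,
        Complex.I_ne_zero, false_or] at e0
      rcases e0 with h | h
      · exact hc h
      · exact h0 h
    rw [LinearIndependent.pair_iff' hne]
    intro a ha
    have e0 := congr_fun ha 0
    have e1 := congr_fun ha 1
    simp only [Pi.smul_apply, smul_eq_mul, Matrix.cons_val_zero, Matrix.cons_val_one] at e0 e1
    -- e0 : a * (c * (I * v 0)) = v 0,  e1 : a * (c * -(I * v 1)) = v 1
    have k0 : a * c * Complex.I = 1 := by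
      have : (a * c * Complex.I - 1) * v 0 = 0 := by linear_combination e0
      rcases mul_eq_zero.mp this with h | h
      · linear_combination h
      · exact absurd h h0
    have : (a * c * Complex.I + 1) * v 1 = 0 := by linear_combination (-1 : ℂ) * e1
    rcases mul_eq_zero.mp this with h | h
    · have h2 : (2 : ℂ) = 0 := by linear_combination h - k0
      norm_num at h2
    · exact h1 h
  · -- generic vector: use the quarter turn
    refine ⟨!![(0 : ℂ), -1; 1, 0], quarterTurn_mem_SU2, ?_⟩
    rw [quarterTurn_mulVec]
    have hne : c • ![-(v 1), v 0] ≠ 0 := by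
      intro h
      have e0 := congr_fun h 0
      have e1 := congr_fun h 1
      simp only [Pi.smul_apply, smul_eq_mul, Matrix.cons_val_zero, Matrix.cons_val_one,
        Pi.zero_apply, mul_eq_zero, neg_eq_zero] at e0 e1
      rcases e0 with h | h
      · exact hc h
      · rcases e1 with h' | h'
        · exact hc h'
        · exact hv' ⟨h', h⟩
    rw [LinearIndependent.pair_iff' hne]
    intro a ha
    have e0 := congr_fun ha 0
    have e1 := congr_fun ha 1
    simp only [Pi.smul_apply, smul_eq_mul, Matrix.cons_val_zero, Matrix.cons_val_one] at e0 e1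
    -- e0 : a * (c * -(v 1)) = v 0,  e1 : a * (c * v 0) = v 1
    apply hq
    have h2 : (1 + (a * c) ^ 2) * v 0 = 0 := by linear_combination (-1 : ℂ) * e0 + (a * c) * e1
    rcases mul_eq_zero.mp h2 with h | h
    · linear_combination (v 0) ^ 2 * h - (v 1 + a * c * v 0) * e1
    · exfalso
      have h3 : v 1 = 0 := by rw [h, mul_zero, mul_zero] at e1; exact e1.symm
      exact hv' ⟨h, h3⟩

/-- Uniform version: ONE `g ∈ SU(2)` moves `v` off its line after every non-zero scalar twist (scalars do not
move lines). [folklore] -/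
theorem exists_SU2_moves_line_twisted (v : Fin 2 → ℂ) (hv : v ≠ 0) :
    ∃ g ∈ Matrix.specialUnitaryGroup (Fin 2) ℂ, ∀ c : ℂ, c ≠ 0 →
      LinearIndependent ℂ ![c • (g *ᵥ v), v] := by
  obtain ⟨g, hg, hli⟩ := exists_SU2_moves_line v hv 1 one_ne_zero
  rw [one_smul] at hli
  exact ⟨g, hg, fun c hc => linearIndependent_pair_smul hli c hc⟩

end SU2Line

end Literature.LinearAlgebra.Matrix
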